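import Literature.Probability.RandomPlanarGeometry.SAWCubeRouting
import HarnessLib

/-!
# Hamiltonian snakes and the snake route: rewiring a walk so that it covers a cube

Topic `Literature/Probability/RandomPlanarGeometry`, infrastructure for Kesten's Pattern Theorem
(Madras–Slade, *The Self-Avoiding Walk* (1993), §7.2), continuing `SAWCubeRouting.lean`. The
proof of Madras–Slade Lemma 7.2.6 ("almost all walks fill some cube") replaces the piece of a
self-avoiding walk inside a cube `Q̄`, between its first entry `x` and last exit `y`, by a walk
inside `Q̄` from `x` to `y` that completely covers a smaller cube `Q` (Lemma 7.2.4(a): a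
corner-to-corner Hamiltonian "snake" of a box exists, by induction on the dimension; Lemma
7.2.4(b): it can be spliced in). We construct this replacement explicitly and uniformly in the
dimension `d + 2 ≥ 2`.

## Contents (namespace `Literature.Probability.RandomPlanarGeometry.SAW.Zd`; all PROVED)

* `snakeList D n` — the **boustrophedon snake** through `{0,…,n}^D` (Lemma 7.2.4(a)), layer by
  layer in the first coordinate with the lower-dimensional snake traversed alternately forwards
  and backwards: `length_snakeList` (`(n+1)^D` points), `mem_snakeList` (exactly the box),
  `nodup_snakeList`, `head_snakeList` (corner `0`), `getLast_snakeList` (corner `(n,…,n)` for even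
  `n`), `isChain_snakeList` (nearest-neighbour chain).
* `GadgetData i R` — an abstract gadget for the axis `i` in the cube of radius `R` (a
  self-avoiding path between two axis points with controlled levels and coordinates), and the
  **generic route** `A7G` (pieces `A1G … A7G`, lengths `m1G … m7G`; the construction of
  `SAWCubeRouting.routeUp` with `13 ↦ R` and the gadget abstracted): `A7G_spec`, `A7G_gadget`,
  `m7G_le`, and `exists_routeG` (**generic routing theorem**: for `x ≠ y` on the outer layer of
  `c + [-R,R]^{d+2}` a self-avoiding path inside the cube from `x` to `y`, of length
  `≤ 12R(d+2) + Λ`, through a translate of one of the given gadgets).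
* `snakeGadget i : GadgetData i 30` — from the axis point at level `-14` one step off the axis to
  the corner `snakeBase i`, the snake through the cube `snakeBase i + {0,…,26}^{d+2}`, one step up
  from the far corner and a greedy path at level `13` back to the axis (`siteListWalk`,
  `pathOn_siteListWalk`, `snakeGadget_covers`, `snakeGadget_marker`).
* `exists_snake_route` — **the snake route**: for `x ≠ y` on the outer layer of
  `c + [-30,30]^{d+2}` a self-avoiding path inside this cube from `x` to `y`, of length at most
  `27^{d+2} + 420(d+2) + 1`, with a time `t₀` such that every point at `ℓ∞`-distance `≤ 13` from
  `π t₀` is a point of `π` (so on the rewired walk the event "the cube of radius `13` centred at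
  the current point is completely covered" occurs — the marker of Lemma 7.2.6).

## References

* N. Madras, G. Slade, *The Self-Avoiding Walk*, Birkhäuser (1993), §7.2, Lemma 7.2.4(a),(b) and
  the proof of Lemma 7.2.6.
-/

noncomputable section

open Filter Topology Literature.Probability.LatticeModels Literature.Probability.Percolation SimpleGraph
open scoped BigOperators

namespace Literature.Probability.RandomPlanarGeometry.SAW.Zd

/-! ### Hamiltonian snakes through boxes (Madras–Slade Lemma 7.2.4(a)) -/

section Snake

/-- One layer of the snake: the lower-dimensional snake `l` (forwards for even `t`, backwards for
odd `t`) placed in the hyperplane `z₀ = t`. [cite: MadrasSlade1993, Lemma 7.2.4(a)] -/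
def snakeBlock {D : ℕ} (l : List (Fin D → ℤ)) (t : ℕ) : List (Fin (D + 1) → ℤ) :=
  (if t % 2 = 0 then l else l.reverse).map (Fin.cons (t : ℤ))

/-- The **boustrophedon snake** through the box `{0, …, n}^D`, as the list of its points in
order: layer by layer in the first coordinate, the `(D-1)`-dimensional snake traversed
alternately forwards and backwards ("filling up each of the `(d-1)`-dimensional cubes
`Q₀, …, Q_b` in turn"). [cite: MadrasSlade1993, Lemma 7.2.4(a)] -/
def snakeList : (D : ℕ) → (n : ℕ) → List (Fin D → ℤ)
  | 0, _ => [Fin.elim0]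
  | D + 1, n => (List.range (n + 1)).flatMap (snakeBlock (snakeList D n))

variable {D : ℕ}

/-- A layer has as many points as the lower-dimensional snake. [folklore] -/
theorem length_snakeBlock (l : List (Fin D → ℤ)) (t : ℕ) : (snakeBlock l t).length = l.length := by
  unfold snakeBlock; split_ifs <;> simp

/-- The snake has `(n+1)^D` points. [folklore] -/
theorem length_snakeList (D n : ℕ) : (snakeList D n).length = (n + 1) ^ D := by
  induction D with
  | zero => simp [snakeList]
  | succ D ih =>
    simp only [snakeList, List.length_flatMap, length_snakeBlock, ih, List.map_const',
      List.sum_replicate, List.length_range, smul_eq_mul, pow_succ]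
    ring

/-- Membership in a layer. [folklore] -/
theorem mem_snakeBlock {l : List (Fin D → ℤ)} {t : ℕ} {z : Fin (D + 1) → ℤ} :
    z ∈ snakeBlock l t ↔ z 0 = t ∧ Fin.tail z ∈ l := by
  unfold snakeBlock
  have hmem : ∀ p, p ∈ (if t % 2 = 0 then l else l.reverse) ↔ p ∈ l := fun p => by
    split_ifs <;> simp
  simp only [List.mem_map, hmem]
  constructor
  · rintro ⟨p, hp, rfl⟩; exact ⟨by simp, by simpa using hp⟩
  · rintro ⟨h0, htl⟩; exact ⟨Fin.tail z, htl, by rw [← h0]; exact Fin.cons_self_tail z⟩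

/-- The points of the snake are exactly the points of the box. [cite: MadrasSlade1993, Lemma 7.2.4(a)] -/
theorem mem_snakeList {D n : ℕ} {z : Fin D → ℤ} : z ∈ snakeList D n ↔ ∀ i, 0 ≤ z i ∧ z i ≤ n := by
  induction D with
  | zero =>
    simp only [snakeList, List.mem_singleton, IsEmpty.forall_iff, iff_true]
    exact Subsingleton.elim _ _
  | succ D ih =>
    simp only [snakeList, List.mem_flatMap, List.mem_range, mem_snakeBlock, ih]
    constructor
    · rintro ⟨t, ht, h0, htl⟩ i
      refine Fin.cases ?_ (fun j => ?_) i
      · rw [h0]; constructor <;> omega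
      · exact htl j
    · intro h
      refine ⟨(z 0).toNat, ?_, ?_, fun j => h j.succ⟩
      · have := h 0; omega
      · have := h 0; omega

/-- The snake visits no point twice. [cite: MadrasSlade1993, Lemma 7.2.4(a)] -/
theorem nodup_snakeList (D n : ℕ) : (snakeList D n).Nodup := by
  induction D with
  | zero => simp [snakeList]
  | succ D ih =>
    simp only [snakeList]
    rw [List.nodup_flatMap]
    constructor
    · intro t _
      unfold snakeBlock
      refine List.Nodup.map (Fin.cons_right_injective _) ?_
      split_ifs
      · exact ih
      · exact List.nodup_reverse.2 ih
    · refine (List.nodup_range).pairwise_of_forall_ne fun a _ b _ hab => ?_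
      simp only [Function.onFun, List.disjoint_left, mem_snakeBlock]
      rintro z ⟨ha, -⟩ ⟨hb, -⟩
      rw [ha] at hb
      exact hab (by exact_mod_cast hb)

/-- The first point of the snake is the corner `0`. [folklore] -/
theorem head_snakeList (D n : ℕ) : (snakeList D n).head? = some 0 := by
  induction D with
  | zero => simp only [snakeList, List.head?_cons, Option.some.injEq]; exact Subsingleton.elim _ _
  | succ D ih =>
    simp only [snakeList]
    rw [List.range_succ_eq_map, List.flatMap_cons, List.head?_append]
    have : (snakeBlock (snakeList D n) 0).head? = some 0 := by
      unfold snakeBlock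
      rw [if_pos rfl, List.head?_map, ih, Option.map_some, Nat.cast_zero]
      congr 1
      exact Fin.cons_self_tail 0
    rw [this, Option.some_or]

/-- For even `n` the last point of the snake is the opposite corner `(n, …, n)`. [folklore] -/
theorem getLast_snakeList (D : ℕ) {n : ℕ} (hn : n % 2 = 0) :
    (snakeList D n).getLast? = some (fun _ => (n : ℤ)) := by
  induction D with
  | zero => simp only [snakeList, List.getLast?_singleton, Option.some.injEq]; exact Subsingleton.elim _ _
  | succ D ih =>
    simp only [snakeList]
    rw [List.range_succ, List.flatMap_append, List.flatMap_singleton, List.getLast?_append]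
    have : (snakeBlock (snakeList D n) n).getLast? = some (fun _ => (n : ℤ)) := by
      unfold snakeBlock
      rw [if_pos hn, List.getLast?_map, ih, Option.map_some]
      congr 1
      funext i
      refine Fin.cases ?_ (fun j => ?_) i <;> simp
    rw [this, Option.some_or]

/-- `Fin.cons t` maps lattice neighbours to lattice neighbours. [folklore] -/
theorem adj_cons {t : ℤ} {a b : Fin D → ℤ} (hab : (zdGraph D).Adj a b) :
    (zdGraph (D + 1)).Adj (Fin.cons t a) (Fin.cons t b) := by
  rw [zdGraph_adj_iff] at hab ⊢
  obtain ⟨i, h | h⟩ := hab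
  · refine ⟨i.succ, Or.inl ?_⟩
    rw [h]
    funext j
    refine Fin.cases ?_ (fun k => ?_) j
    · simp
    · simp [Pi.single_apply, Fin.succ_inj]
  · refine ⟨i.succ, Or.inr ?_⟩
    rw [h]
    funext j
    refine Fin.cases ?_ (fun k => ?_) j
    · simp
    · simp [Pi.single_apply, Fin.succ_inj]

/-- Points differing by one in the first coordinate are neighbours. [folklore] -/
theorem adj_cons_succ (t : ℕ) (a : Fin D → ℤ) :
    (zdGraph (D + 1)).Adj (Fin.cons (t : ℤ) a) (Fin.cons ((t + 1 : ℕ) : ℤ) a) := by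
  rw [zdGraph_adj_iff]
  refine ⟨0, Or.inl ?_⟩
  funext j
  refine Fin.cases ?_ (fun k => ?_) j
  · simp
  · simp

/-- Each layer is a nearest-neighbour chain. [folklore] -/
theorem isChain_snakeBlock {l : List (Fin D → ℤ)} (hl : l.IsChain (zdGraph D).Adj) (t : ℕ) :
    (snakeBlock l t).IsChain (zdGraph (D + 1)).Adj := by
  unfold snakeBlock
  refine List.isChain_map_of_isChain (Fin.cons (t : ℤ)) (fun a b hab => adj_cons hab) ?_
  split_ifs
  · exact hl
  · exact List.isChain_reverse.2 (hl.imp fun _ _ h => h.symm)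

/-- Consecutive points of the snake are nearest neighbours. [cite: MadrasSlade1993, Lemma 7.2.4(a)] -/
theorem isChain_snakeList (D : ℕ) {n : ℕ} (hn : n % 2 = 0) :
    (snakeList D n).IsChain (zdGraph D).Adj := by
  induction D with
  | zero => simp [snakeList]
  | succ D ih =>
    have h0 := head_snakeList D n
    have hL := getLast_snakeList D hn
    have hne : ∀ t, snakeBlock (snakeList D n) t ≠ [] := fun t => by
      rw [← List.length_pos_iff_ne_nil, length_snakeBlock, length_snakeList]; positivity
    -- the junction between layers `t` and `t + 1`
    have hjunct : ∀ t, ∀ a ∈ (snakeBlock (snakeList D n) t).getLast?,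
        ∀ b ∈ (snakeBlock (snakeList D n) (t + 1)).head?, (zdGraph (D + 1)).Adj a b := by
      intro t a ha b hb
      simp only [snakeBlock, Option.mem_def] at ha hb
      rcases Nat.mod_two_eq_zero_or_one t with ht | ht
      · have ht' : ¬ (t + 1) % 2 = 0 := by omega
        rw [if_pos ht, List.getLast?_map, hL] at ha
        rw [if_neg ht', List.head?_map, List.head?_reverse, hL] at hb
        simp only [Option.map_some, Option.some.injEq] at ha hb
        subst ha; subst hb
        exact adj_cons_succ t _
      · have ht' : (t + 1) % 2 = 0 := by omega
        rw [if_neg (by omega), List.getLast?_map, List.getLast?_reverse, h0] at ha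
        rw [if_pos ht', List.head?_map, h0] at hb
        simp only [Option.map_some, Option.some.injEq] at ha hb
        subst ha; subst hb
        exact adj_cons_succ t _
    have key : ∀ m, ((List.range (m + 1)).flatMap (snakeBlock (snakeList D n))).IsChain
        (zdGraph (D + 1)).Adj := by
      intro m
      induction m with
      | zero => simpa using isChain_snakeBlock ih 0
      | succ m ihm =>
        rw [List.range_succ, List.flatMap_append, List.flatMap_singleton]
        refine ihm.append (isChain_snakeBlock ih _) fun a ha b hb => ?_
        rw [List.range_succ, List.flatMap_append, List.flatMap_singleton,
          List.getLast?_append_of_ne_nil _ (hne m)] at ha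
        exact hjunct m a ha b hb
    exact key n

end Snake

/-! ### Generic gadgets and the generic route in a cube of radius `R` -/

section GadgetData

variable {d : ℕ}

/-- An abstract **gadget** for the axis `i` in the cube of radius `R`: a self-avoiding path `g`
from the axis point at level `lo` to the axis point at level `hi`, whose points have levels in
`[lo, hi]` and all coordinates at most `β < R`. [folklore] -/
structure GadgetData (i : Fin (d + 2)) (R : ℤ) where
  /-- the gadget walk -/
  g : ℕ → Site (d + 2)
  /-- its length -/
  len : ℕ
  /-- entry level -/
  lo : ℤ
  /-- exit level -/
  hi : ℤ
  /-- bound on all coordinates of all points -/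
  β : ℤ
  /-- the gadget is a self-avoiding path -/
  pathOn : PathOn len g
  /-- it starts on the axis at level `lo` -/
  g_zero : g 0 = Pi.single i lo
  /-- it ends on the axis at level `hi` -/
  g_len : g len = Pi.single i hi
  /-- levels and coordinates of its points -/
  ranges : ∀ {t}, t ≤ len → (lo ≤ g t i ∧ g t i ≤ hi) ∧ ∀ j, |g t j| ≤ β
  /-- numerical constraints -/
  bounds : -R < lo ∧ lo < hi ∧ hi < R ∧ 0 ≤ β ∧ β < R

/-- `x⁻` at radius `R`. [folklore] -/
def dropPtG (R : ℤ) (i : Fin (d + 2)) (x : Site (d + 2)) : Site (d + 2) := Function.update x i (-R)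

/-- `y⁺` at radius `R`. [folklore] -/
def liftPtG (R : ℤ) (i : Fin (d + 2)) (y : Site (d + 2)) : Site (d + 2) := Function.update y i R

/-- An outer-layer point whose transverse coordinates are small has extreme level (radius `R`).
[folklore] -/
theorem level_eq_of_transverse_smallG {R : ℤ} {i : Fin (d + 2)} {x : Site (d + 2)}
    (hxL : ∃ j, |x j| = R) (h : ∀ j, j ≠ i → |x j| ≤ R - 1) : |x i| = R := by
  obtain ⟨j, hj⟩ := hxL
  by_cases hji : j = i
  · rw [← hji]; exact hj
  · have := h j hji; omega

end GadgetData

section Predicates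

variable {d : ℕ}

/-- Points of the cube of radius `R`. [folklore] -/
def InBoxR (R : ℤ) (z : Site (d + 2)) : Prop := ∀ j, |z j| ≤ R

/-- Points of piece 1 (the segment below `x`). [folklore] -/
def PS1G (R : ℤ) (i : Fin (d + 2)) (x z : Site (d + 2)) : Prop :=
  (∀ j, j ≠ i → z j = x j) ∧ -R ≤ z i ∧ z i ≤ x i

/-- Points of the lower axis. [folklore] -/
def PAXloG {R : ℤ} {i : Fin (d + 2)} (G : GadgetData i R) (z : Site (d + 2)) : Prop :=
  (∀ j, j ≠ i → z j = 0) ∧ z i ≤ G.lo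

/-- Points of the gadget region. [folklore] -/
def PGDG {R : ℤ} {i : Fin (d + 2)} (G : GadgetData i R) (z : Site (d + 2)) : Prop :=
  G.lo ≤ z i ∧ z i ≤ G.hi ∧ ∀ j, |z j| ≤ G.β

/-- Points of the upper axis. [folklore] -/
def PAXhiG {R : ℤ} {i : Fin (d + 2)} (G : GadgetData i R) (z : Site (d + 2)) : Prop :=
  (∀ j, j ≠ i → z j = 0) ∧ G.hi ≤ z i

/-- Points of piece 7 (the segment above `y`). [folklore] -/
def PS7G (R : ℤ) (i : Fin (d + 2)) (y z : Site (d + 2)) : Prop :=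
  (∀ j, j ≠ i → z j = y j) ∧ y i ≤ z i ∧ z i ≤ R

/-- Points of the first `k` pieces, `k = 2, …, 6`. [folklore] -/
def PQG {R : ℤ} {i : Fin (d + 2)} (G : GadgetData i R) (k : ℕ) (x z : Site (d + 2)) : Prop :=
  PS1G R i x z ∨ z i = -R ∨ (3 ≤ k ∧ PAXloG G z) ∨ (4 ≤ k ∧ PGDG G z) ∨ (5 ≤ k ∧ PAXhiG G z) ∨
    (6 ≤ k ∧ z i = R)

/-- Monotonicity of the cumulative predicates. [folklore] -/
theorem PQG.mono {R : ℤ} {i : Fin (d + 2)} {G : GadgetData i R} {k k' : ℕ} {x z : Site (d + 2)}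
    (h : PQG G k x z) (hk : k ≤ k') : PQG G k' x z := by
  rcases h with h | h | ⟨h1, h2⟩ | ⟨h1, h2⟩ | ⟨h1, h2⟩ | ⟨h1, h2⟩
  · exact Or.inl h
  · exact Or.inr (Or.inl h)
  · exact Or.inr (Or.inr (Or.inl ⟨by omega, h2⟩))
  · exact Or.inr (Or.inr (Or.inr (Or.inl ⟨by omega, h2⟩)))
  · exact Or.inr (Or.inr (Or.inr (Or.inr (Or.inl ⟨by omega, h2⟩))))
  · exact Or.inr (Or.inr (Or.inr (Or.inr (Or.inr ⟨by omega, h2⟩))))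

end Predicates

/-! #### The pieces one by one -/

section Pieces

variable {d : ℕ}

/-- `x⁻` agrees with `x` off `i` and has level `-R`. [folklore] -/
theorem dropPtG_spec (R : ℤ) (i : Fin (d + 2)) (x : Site (d + 2)) : (∀ j, j ≠ i → x j = dropPtG R i x j) ∧ dropPtG R i x i = -R := by
  refine ⟨fun j hj => ?_, by simp [dropPtG]⟩
  simp [dropPtG, Function.update_of_ne hj]

/-- `y⁺` agrees with `y` off `i` and has level `R`. [folklore] -/
theorem liftPtG_spec (R : ℤ) (i : Fin (d + 2)) (y : Site (d + 2)) : (∀ j, j ≠ i → liftPtG R i y j = y j) ∧ liftPtG R i y i = R := by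
  refine ⟨fun j hj => ?_, by simp [liftPtG]⟩
  simp [liftPtG, Function.update_of_ne hj]

/-- Piece 1: from `x` down to `x⁻`. [folklore] -/
theorem piece1G_spec (R : ℤ) (i : Fin (d + 2)) (x : Site (d + 2)) (hx : ∀ j, |x j| ≤ R) (t : ℕ) :
    PS1G R i x (gpath x (dropPtG R i x) t) ∧ InBoxR R (gpath x (dropPtG R i x) t) ∧
      (t < dist1 x (dropPtG R i x) → -R < gpath x (dropPtG R i x) t i) := by
  obtain ⟨hag, hlev⟩ := dropPtG_spec R i x
  have hxi : -R ≤ x i := by have := hx i; rw [abs_le] at this; exact this.1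
  have htr : ∀ j, j ≠ i → gpath x (dropPtG R i x) t j = x j := fun j hj => by
    rw [gpath_apply_of_eq (hag j hj)]
  have hmem := gpath_apply_mem x (dropPtG R i x) i t
  rw [hlev, min_eq_right hxi, max_eq_left hxi] at hmem
  refine ⟨⟨htr, hmem.1, hmem.2⟩, fun j => ?_, fun ht => ?_⟩
  · by_cases hj : j = i
    · subst hj; rw [abs_le]; have := hx j; rw [abs_le] at this; exact ⟨hmem.1, hmem.2.trans this.2⟩
    · rw [htr j hj]; exact hx j
  · have := gpath_level_of_ge hag (by rw [hlev]; exact hxi) ht.le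
    rw [hlev] at this
    omega

/-- Piece 2: inside the bottom face from `x⁻` to its centre. [folklore] -/
theorem piece2G_spec (R : ℤ) (i : Fin (d + 2)) (x : Site (d + 2)) (hx : ∀ j, |x j| ≤ R) (t : ℕ) :
    gpath (dropPtG R i x) (Pi.single i (-R)) t i = -R ∧
      InBoxR R (gpath (dropPtG R i x) (Pi.single i (-R)) t) := by
  obtain ⟨hag, hlev⟩ := dropPtG_spec R i x
  have h1 : gpath (dropPtG R i x) (Pi.single i (-R)) t i = -R := by
    rw [gpath_apply_of_eq (by rw [hlev]; simp), hlev]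
  have hR : 0 ≤ R := le_trans (abs_nonneg _) (hx i)
  refine ⟨h1, fun j => ?_⟩
  by_cases hj : j = i
  · subst hj; rw [h1, abs_neg, abs_of_nonneg hR]
  · have hmem := gpath_apply_mem (dropPtG R i x) (Pi.single i (-R)) j t
    rw [Pi.single_eq_of_ne hj, ← hag j hj] at hmem
    have := hx j
    rw [abs_le] at this ⊢
    exact ⟨le_trans (le_min this.1 (by omega)) hmem.1, le_trans hmem.2 (max_le this.2 hR)⟩

/-- Piece 3: the lower axis from the bottom face centre up to the gadget entry. [folklore] -/
theorem piece3G_spec {R : ℤ} {i : Fin (d + 2)} (G : GadgetData i R) (t : ℕ) (ht : t ≤ dist1 (Pi.single i (-R) : Site (d + 2)) (Pi.single i (G.lo))) :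
    (∀ j, j ≠ i → gpath (Pi.single i (-R) : Site (d + 2)) (Pi.single i (G.lo)) t j = 0) ∧
      gpath (Pi.single i (-R) : Site (d + 2)) (Pi.single i (G.lo)) t i =
        G.lo - ((dist1 (Pi.single i (-R) : Site (d + 2)) (Pi.single i (G.lo)) - t : ℕ) : ℤ) ∧
      (dist1 (Pi.single i (-R) : Site (d + 2)) (Pi.single i (G.lo)) : ℤ) = G.lo + R := by
  have hb := G.bounds
  have hag : ∀ j, j ≠ i → (Pi.single i (-R) : Site (d + 2)) j = (Pi.single i (G.lo) : Site (d + 2)) j :=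
    fun j hj => by rw [Pi.single_eq_of_ne hj, Pi.single_eq_of_ne hj]
  refine ⟨fun j hj => ?_, ?_, ?_⟩
  · rw [gpath_transverse hag t j hj, Pi.single_eq_of_ne hj]
  · have := gpath_level_of_le hag (by simp only [Pi.single_eq_same]; omega) ht
    simpa using this
  · rw [dist1_single_coord hag]; simp only [Pi.single_eq_same]; rw [abs_of_nonneg (by omega)]; ring

/-- Piece 5: the upper axis from the gadget exit to the top face centre. [folklore] -/
theorem piece5G_spec {R : ℤ} {i : Fin (d + 2)} (G : GadgetData i R) (t : ℕ) (ht : t ≤ dist1 (Pi.single i (G.hi) : Site (d + 2)) (Pi.single i R)) :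
    (∀ j, j ≠ i → gpath (Pi.single i (G.hi) : Site (d + 2)) (Pi.single i R) t j = 0) ∧
      gpath (Pi.single i (G.hi) : Site (d + 2)) (Pi.single i R) t i =
        R - ((dist1 (Pi.single i (G.hi) : Site (d + 2)) (Pi.single i R) - t : ℕ) : ℤ) ∧
      (dist1 (Pi.single i (G.hi) : Site (d + 2)) (Pi.single i R) : ℤ) = R - G.hi := by
  have hb := G.bounds
  have hag : ∀ j, j ≠ i → (Pi.single i (G.hi) : Site (d + 2)) j = (Pi.single i R : Site (d + 2)) j :=
    fun j hj => by rw [Pi.single_eq_of_ne hj, Pi.single_eq_of_ne hj]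
  refine ⟨fun j hj => ?_, ?_, ?_⟩
  · rw [gpath_transverse hag t j hj, Pi.single_eq_of_ne hj]
  · have := gpath_level_of_le hag (by simp only [Pi.single_eq_same]; omega) ht
    simpa using this
  · rw [dist1_single_coord hag]; simp only [Pi.single_eq_same]; rw [abs_of_nonneg (by omega)]

/-- Piece 6: inside the top face from its centre to `y⁺`. [folklore] -/
theorem piece6G_spec (R : ℤ) (i : Fin (d + 2)) (y : Site (d + 2)) (hy : ∀ j, |y j| ≤ R) (t : ℕ) :
    gpath (Pi.single i R) (liftPtG R i y) t i = R ∧ InBoxR R (gpath (Pi.single i R) (liftPtG R i y) t) := by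
  obtain ⟨hag, hlev⟩ := liftPtG_spec R i y
  have h1 : gpath (Pi.single i R) (liftPtG R i y) t i = R := by
    rw [gpath_apply_of_eq (by rw [hlev]; simp)]; simp
  have hR : 0 ≤ R := le_trans (abs_nonneg _) (hy i)
  refine ⟨h1, fun j => ?_⟩
  by_cases hj : j = i
  · subst hj; rw [h1, abs_of_nonneg hR]
  · have hmem := gpath_apply_mem (Pi.single i R : Site (d + 2)) (liftPtG R i y) j t
    rw [Pi.single_eq_of_ne hj, hag j hj] at hmem
    have := hy j
    rw [abs_le] at this ⊢
    exact ⟨le_trans (le_min (by omega) this.1) hmem.1, le_trans hmem.2 (max_le hR this.2)⟩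

/-- Piece 7: from `y⁺` down to `y`. [folklore] -/
theorem piece7G_spec (R : ℤ) (i : Fin (d + 2)) (y : Site (d + 2)) (hy : ∀ j, |y j| ≤ R) (t : ℕ) (ht : t ≤ dist1 (liftPtG R i y) y) :
    PS7G R i y (gpath (liftPtG R i y) y t) ∧ InBoxR R (gpath (liftPtG R i y) y t) ∧
      gpath (liftPtG R i y) y t i = y i + ((dist1 (liftPtG R i y) y - t : ℕ) : ℤ) ∧
      (dist1 (liftPtG R i y) y : ℤ) = R - y i := by
  obtain ⟨hag, hlev⟩ := liftPtG_spec R i y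
  have hyi : y i ≤ R := by have := hy i; rw [abs_le] at this; exact this.2
  have htr : ∀ j, j ≠ i → gpath (liftPtG R i y) y t j = y j := fun j hj => by
    rw [gpath_apply_of_eq (hag j hj), hag j hj]
  have hform := gpath_level_of_ge hag (by rw [hlev]; exact hyi) ht
  have hdist : (dist1 (liftPtG R i y) y : ℤ) = R - y i := by
    rw [dist1_single_coord hag, hlev, abs_of_nonpos (by omega)]; ring
  have hmem := gpath_apply_mem (liftPtG R i y) y i t
  rw [hlev, min_eq_right hyi, max_eq_left hyi] at hmem
  refine ⟨⟨htr, hmem.1, hmem.2⟩, fun j => ?_, hform, hdist⟩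
  by_cases hj : j = i
  · subst hj; rw [abs_le]; have := hy j; rw [abs_le] at this; exact ⟨this.1.trans hmem.1, hmem.2⟩
  · rw [htr j hj]; exact hy j

end Pieces

/-! #### The cumulative walks `A₁ ⊂ A₂ ⊂ ⋯ ⊂ A₇ = routeG` -/

section Cumulative

variable {d : ℕ}

/-- Length after piece 1. [folklore] -/
def m1G (R : ℤ) (i : Fin (d + 2)) (x : Site (d + 2)) : ℕ := dist1 x (dropPtG R i x)
/-- Length after piece 2. [folklore] -/
def m2G (R : ℤ) (i : Fin (d + 2)) (x : Site (d + 2)) : ℕ := m1G R i x + dist1 (dropPtG R i x) (Pi.single i (-R))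
/-- Length after piece 3. [folklore] -/
def m3G {R : ℤ} {i : Fin (d + 2)} (G : GadgetData i R) (x : Site (d + 2)) : ℕ :=
  m2G R i x + dist1 (Pi.single i (-R) : Site (d + 2)) (Pi.single i (G.lo))
/-- Length after piece 4. [folklore] -/
def m4G {R : ℤ} {i : Fin (d + 2)} (G : GadgetData i R) (x : Site (d + 2)) : ℕ := m3G G x + G.len
/-- Length after piece 5. [folklore] -/
def m5G {R : ℤ} {i : Fin (d + 2)} (G : GadgetData i R) (x : Site (d + 2)) : ℕ :=
  m4G G x + dist1 (Pi.single i (G.hi) : Site (d + 2)) (Pi.single i R)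
/-- Length after piece 6. [folklore] -/
def m6G {R : ℤ} {i : Fin (d + 2)} (G : GadgetData i R) (x y : Site (d + 2)) : ℕ :=
  m5G G x + dist1 (Pi.single i R) (liftPtG R i y)
/-- Length after piece 7 (the length of `routeG`). [folklore] -/
def m7G {R : ℤ} {i : Fin (d + 2)} (G : GadgetData i R) (x y : Site (d + 2)) : ℕ :=
  m6G G x y + dist1 (liftPtG R i y) y

/-- `A₁`. [folklore] -/
def A1G (R : ℤ) (i : Fin (d + 2)) (x : Site (d + 2)) : ℕ → Site (d + 2) := gpath x (dropPtG R i x)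
/-- `A₂`. [folklore] -/
def A2G (R : ℤ) (i : Fin (d + 2)) (x : Site (d + 2)) : ℕ → Site (d + 2) :=
  pappend (m1G R i x) (A1G R i x) (gpath (dropPtG R i x) (Pi.single i (-R)))
/-- `A₃`. [folklore] -/
def A3G {R : ℤ} {i : Fin (d + 2)} (G : GadgetData i R) (x : Site (d + 2)) : ℕ → Site (d + 2) :=
  pappend (m2G R i x) (A2G R i x) (gpath (Pi.single i (-R) : Site (d + 2)) (Pi.single i (G.lo)))
/-- `A₄`. [folklore] -/
def A4G {R : ℤ} {i : Fin (d + 2)} (G : GadgetData i R) (x : Site (d + 2)) : ℕ → Site (d + 2) :=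
  pappend (m3G G x) (A3G G x) G.g
/-- `A₅`. [folklore] -/
def A5G {R : ℤ} {i : Fin (d + 2)} (G : GadgetData i R) (x : Site (d + 2)) : ℕ → Site (d + 2) :=
  pappend (m4G G x) (A4G G x) (gpath (Pi.single i (G.hi) : Site (d + 2)) (Pi.single i R))
/-- `A₆`. [folklore] -/
def A6G {R : ℤ} {i : Fin (d + 2)} (G : GadgetData i R) (x y : Site (d + 2)) : ℕ → Site (d + 2) :=
  pappend (m5G G x) (A5G G x) (gpath (Pi.single i R) (liftPtG R i y))
/-- `A₇`. [folklore] -/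
def A7G {R : ℤ} {i : Fin (d + 2)} (G : GadgetData i R) (x y : Site (d + 2)) : ℕ → Site (d + 2) :=
  pappend (m6G G x y) (A6G G x y) (gpath (liftPtG R i y) y)


/-- If the transverse coordinates of `x` are small then `xᵢ = -R`. [folklore] -/
theorem xi_eq_of_smallG {R : ℤ} {i : Fin (d + 2)} {x y : Site (d + 2)} (hxL : ∃ j, |x j| = R) (hy : ∀ j, |y j| ≤ R) (hlt : x i < y i)
    (h : ∀ j, j ≠ i → |x j| ≤ R - 1) : x i = -R := by
  have hR : 0 ≤ R := by obtain ⟨j, hj⟩ := hxL; rw [← hj]; exact abs_nonneg _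
  have h1 := level_eq_of_transverse_smallG hxL h
  have h2 := hy i
  rw [abs_le] at h2
  rcases (abs_eq hR).1 h1 with h3 | h3 <;> omega

/-- If the transverse coordinates of `y` are small then `yᵢ = R`. [folklore] -/
theorem yi_eq_of_smallG {R : ℤ} {i : Fin (d + 2)} {x y : Site (d + 2)} (hx : ∀ j, |x j| ≤ R) (hyL : ∃ j, |y j| = R) (hlt : x i < y i)
    (h : ∀ j, j ≠ i → |y j| ≤ R - 1) : y i = R := by
  have hR : 0 ≤ R := by obtain ⟨j, hj⟩ := hyL; rw [← hj]; exact abs_nonneg _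
  have h1 := level_eq_of_transverse_smallG hyL h
  have h2 := hx i
  rw [abs_le] at h2
  rcases (abs_eq hR).1 h1 with h3 | h3 <;> omega

/-- `A₁`: path, endpoints, points. [folklore] -/
theorem A1G_spec {R : ℤ} {i : Fin (d + 2)} (G : GadgetData i R) {x : Site (d + 2)} (hx : ∀ j, |x j| ≤ R) :
    PathOn (m1G R i x) (A1G R i x) ∧ A1G R i x 0 = x ∧ A1G R i x (m1G R i x) = dropPtG R i x ∧
    ∀ t ≤ m1G R i x, PQG G 1 x (A1G R i x t) ∧ InBoxR R (A1G R i x t) := by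
  refine ⟨pathOn_gpath _ _, rfl, gpath_of_ge _ _ le_rfl, fun t _ => ?_⟩
  have := piece1G_spec R i x hx t
  exact ⟨Or.inl this.1, this.2.1⟩

/-- `A₂`: path, endpoints, points. [folklore] -/
theorem A2G_spec {R : ℤ} {i : Fin (d + 2)} (G : GadgetData i R) {x : Site (d + 2)} (hx : ∀ j, |x j| ≤ R) :
    PathOn (m2G R i x) (A2G R i x) ∧ A2G R i x 0 = x ∧ A2G R i x (m2G R i x) = Pi.single i (-R) ∧
    ∀ t ≤ m2G R i x, PQG G 2 x (A2G R i x t) ∧ InBoxR R (A2G R i x t) := by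
  obtain ⟨hP, h0, hend, hpts⟩ := A1G_spec G hx
  have hj : A1G R i x (m1G R i x) = gpath (dropPtG R i x) (Pi.single i (-R)) 0 := by rw [hend]; rfl
  refine ⟨?_, ?_, ?_, ?_⟩
  · refine hP.append (pathOn_gpath _ _) hj fun s hs t ht1 ht2 heq => ?_
    have h1 := (piece1G_spec R i x hx s).2.2 hs
    have h2 := (piece2G_spec R i x hx t).1
    have := congrFun heq i
    simp only [A1G] at this
    rw [this, h2] at h1
    exact lt_irrefl _ h1
  · unfold A2G; rw [pappend_of_le _ _ (Nat.zero_le _), h0]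
  · unfold A2G m2G; rw [pappend_add _ _ _ _ hj, gpath_of_ge _ _ le_rfl]
  · intro t ht
    unfold A2G
    rcases le_or_gt t (m1G R i x) with h | h
    · rw [pappend_of_le _ _ h]; exact ⟨(hpts t h).1.mono (by norm_num), (hpts t h).2⟩
    · obtain ⟨k, rfl⟩ : ∃ k, t = m1G R i x + k := ⟨t - m1G R i x, by omega⟩
      rw [pappend_add _ _ _ _ hj]
      have := piece2G_spec R i x hx k
      exact ⟨Or.inr (Or.inl this.1), this.2⟩

/-- `A₃`: path, endpoints, points. [folklore] -/
theorem A3G_spec {R : ℤ} {i : Fin (d + 2)} (G : GadgetData i R) {x y : Site (d + 2)} (hx : ∀ j, |x j| ≤ R) (hxL : ∃ j, |x j| = R) (hy : ∀ j, |y j| ≤ R) (hlt : x i < y i) :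
    PathOn (m3G G x) (A3G G x) ∧ A3G G x 0 = x ∧ A3G G x (m3G G x) = Pi.single i (G.lo) ∧
    ∀ t ≤ m3G G x, PQG G 3 x (A3G G x t) ∧ InBoxR R (A3G G x t) := by
  obtain ⟨hP, h0, hend, hpts⟩ := A2G_spec G hx
  have hb := G.bounds
  have hj : A2G R i x (m2G R i x) = (gpath (Pi.single i (-R) : Site (d + 2)) (Pi.single i (G.lo))) 0 := by rw [hend]; rfl
  -- points of piece 3
  have p3 : ∀ t ≤ (dist1 (Pi.single i (-R) : Site (d + 2)) (Pi.single i (G.lo))), (∀ j, j ≠ i → (gpath (Pi.single i (-R) : Site (d + 2)) (Pi.single i (G.lo))) t j = 0) ∧ (gpath (Pi.single i (-R) : Site (d + 2)) (Pi.single i (G.lo))) t i = (t : ℤ) - R := by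
    intro t ht
    obtain ⟨htr, hlev, hlen⟩ := piece3G_spec G t ht
    refine ⟨htr, ?_⟩
    rw [hlev]; push_cast [Nat.cast_sub ht]; linarith
  refine ⟨?_, ?_, ?_, ?_⟩
  · refine hP.append (pathOn_gpath _ _) hj fun s hs t ht1 ht2 heq => ?_
    have hz := (hpts s hs.le).1
    obtain ⟨htr, hlev⟩ := p3 t ht2
    have hlevz : A2G R i x s i = (t : ℤ) - R := by rw [heq]; exact hlev
    rcases hz with hz | hz | ⟨h, -⟩ | ⟨h, -⟩ | ⟨h, -⟩ | ⟨h, -⟩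
    · -- piece-1 point: its transverse coordinates vanish, so `x i = -R`
      have hsmall : ∀ j, j ≠ i → |x j| ≤ R - 1 := fun j hj => by
        rw [← hz.1 j hj, heq, htr j hj]; simp only [abs_zero]; omega
      have := xi_eq_of_smallG hxL hy hlt hsmall
      have h3 := hz.2.2
      omega
    · omega
    · omega
    · omega
    · omega
    · omega
  · unfold A3G; rw [pappend_of_le _ _ (Nat.zero_le _), h0]
  · unfold A3G m3G; rw [pappend_add _ _ _ _ hj, gpath_of_ge _ _ le_rfl]
  · intro t ht
    unfold A3G
    rcases le_or_gt t (m2G R i x) with h | h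
    · rw [pappend_of_le _ _ h]; exact ⟨(hpts t h).1.mono (by norm_num), (hpts t h).2⟩
    · obtain ⟨k, rfl⟩ : ∃ k, t = m2G R i x + k := ⟨t - m2G R i x, by omega⟩
      have hk : k ≤ (dist1 (Pi.single i (-R) : Site (d + 2)) (Pi.single i (G.lo))) := by unfold m3G at ht; omega
      rw [pappend_add _ _ _ _ hj]
      obtain ⟨htr, hlev⟩ := p3 k hk
      have hlen : ((dist1 (Pi.single i (-R) : Site (d + 2)) (Pi.single i (G.lo))) : ℤ) = G.lo + R := (piece3G_spec G k hk).2.2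
      refine ⟨Or.inr (Or.inr (Or.inl ⟨le_rfl, htr, by rw [hlev]; omega⟩)), fun j => ?_⟩
      by_cases hji : j = i
      · subst hji; rw [hlev, abs_le]; constructor <;> omega
      · rw [htr j hji]; simp only [abs_zero]; omega

/-- `A₄`: path, endpoints, points. [folklore] -/
theorem A4G_spec {R : ℤ} {i : Fin (d + 2)} (G : GadgetData i R) {x y : Site (d + 2)} (hx : ∀ j, |x j| ≤ R) (hxL : ∃ j, |x j| = R) (hy : ∀ j, |y j| ≤ R) (hlt : x i < y i) :
    PathOn (m4G G x) (A4G G x) ∧ A4G G x 0 = x ∧ A4G G x (m4G G x) = Pi.single i (G.hi) ∧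
    ∀ t ≤ m4G G x, PQG G 4 x (A4G G x t) ∧ InBoxR R (A4G G x t) := by
  obtain ⟨hP, h0, hend, hpts⟩ := A3G_spec G hx hxL hy hlt
  have hb := G.bounds
  have hj : A3G G x (m3G G x) = G.g 0 := by rw [hend, G.g_zero]
  refine ⟨?_, ?_, ?_, ?_⟩
  · refine hP.append (G.pathOn) hj fun s hs t ht1 ht2 heq => ?_
    have hz := (hpts s hs.le).1
    obtain ⟨⟨hglo, hghi⟩, hgabs⟩ := G.ranges ht2
    rcases hz with hz | hz | ⟨-, hz⟩ | ⟨h, -⟩ | ⟨h, -⟩ | ⟨h, -⟩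
    · have hsmall : ∀ j, j ≠ i → |x j| ≤ R - 1 := fun j hj => by
        rw [← hz.1 j hj, heq]; exact (hgabs j).trans (by omega)
      have := xi_eq_of_smallG hxL hy hlt hsmall
      have h3 := hz.2.2
      rw [heq] at h3
      omega
    · rw [heq] at hz; omega
    · -- lower-axis point: it must be the gadget entry, excluded by injectivity
      have hlev : G.g t i = G.lo := by
        have := hz.2; rw [heq] at this; omega
      have htr : ∀ j, j ≠ i → G.g t j = 0 := fun j hj => by rw [← heq]; exact hz.1 j hj
      have heq' : G.g t = G.g 0 := by
        rw [eq_single_of_transverse htr, hlev, G.g_zero]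
      have := (G.pathOn).2 (show t ≤ G.len from ht2) (Nat.zero_le _) heq'
      omega
    · omega
    · omega
    · omega
  · unfold A4G; rw [pappend_of_le _ _ (Nat.zero_le _), h0]
  · unfold A4G m4G; rw [pappend_add _ _ _ _ hj, G.g_len]
  · intro t ht
    unfold A4G
    rcases le_or_gt t (m3G G x) with h | h
    · rw [pappend_of_le _ _ h]; exact ⟨(hpts t h).1.mono (by norm_num), (hpts t h).2⟩
    · obtain ⟨k, rfl⟩ : ∃ k, t = m3G G x + k := ⟨t - m3G G x, by omega⟩
      have hk : k ≤ G.len := by unfold m4G at ht; omega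
      rw [pappend_add _ _ _ _ hj]
      obtain ⟨⟨hglo, hghi⟩, hgabs⟩ := G.ranges hk
      exact ⟨Or.inr (Or.inr (Or.inr (Or.inl ⟨le_rfl, hglo, hghi, hgabs⟩))),
        fun j => (hgabs j).trans (by omega)⟩

/-- `A₅`: path, endpoints, points. [folklore] -/
theorem A5G_spec {R : ℤ} {i : Fin (d + 2)} (G : GadgetData i R) {x y : Site (d + 2)} (hx : ∀ j, |x j| ≤ R) (hxL : ∃ j, |x j| = R) (hy : ∀ j, |y j| ≤ R) (hlt : x i < y i) :
    PathOn (m5G G x) (A5G G x) ∧ A5G G x 0 = x ∧ A5G G x (m5G G x) = Pi.single i R ∧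
    ∀ t ≤ m5G G x, PQG G 5 x (A5G G x t) ∧ InBoxR R (A5G G x t) := by
  obtain ⟨hP, h0, hend, hpts⟩ := A4G_spec G hx hxL hy hlt
  have hb := G.bounds
  have hj : A4G G x (m4G G x) = (gpath (Pi.single i (G.hi) : Site (d + 2)) (Pi.single i R)) 0 := by rw [hend]; rfl
  have p5 : ∀ t ≤ (dist1 (Pi.single i (G.hi) : Site (d + 2)) (Pi.single i R)), (∀ j, j ≠ i → (gpath (Pi.single i (G.hi) : Site (d + 2)) (Pi.single i R)) t j = 0) ∧ (gpath (Pi.single i (G.hi) : Site (d + 2)) (Pi.single i R)) t i = G.hi + t := by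
    intro t ht
    obtain ⟨htr, hlev, hlen⟩ := piece5G_spec G t ht
    refine ⟨htr, ?_⟩
    rw [hlev]; push_cast [Nat.cast_sub ht]; linarith
  refine ⟨?_, ?_, ?_, ?_⟩
  · refine hP.append (pathOn_gpath _ _) hj fun s hs t ht1 ht2 heq => ?_
    have hz := (hpts s hs.le).1
    obtain ⟨htr, hlev⟩ := p5 t ht2
    have hlevz : A4G G x s i = G.hi + t := by rw [heq]; exact hlev
    rcases hz with hz | hz | ⟨-, hz⟩ | ⟨-, hz⟩ | ⟨h, -⟩ | ⟨h, -⟩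
    · have hsmall : ∀ j, j ≠ i → |x j| ≤ R - 1 := fun j hj => by
        rw [← hz.1 j hj, heq, htr j hj]; simp only [abs_zero]; omega
      have := xi_eq_of_smallG hxL hy hlt hsmall
      have h3 := hz.2.2
      omega
    · omega
    · have := hz.2; omega
    · have := hz.2.1; omega
    · omega
    · omega
  · unfold A5G; rw [pappend_of_le _ _ (Nat.zero_le _), h0]
  · unfold A5G m5G; rw [pappend_add _ _ _ _ hj, gpath_of_ge _ _ le_rfl]
  · intro t ht
    unfold A5G
    rcases le_or_gt t (m4G G x) with h | h
    · rw [pappend_of_le _ _ h]; exact ⟨(hpts t h).1.mono (by norm_num), (hpts t h).2⟩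
    · obtain ⟨k, rfl⟩ : ∃ k, t = m4G G x + k := ⟨t - m4G G x, by omega⟩
      have hk : k ≤ (dist1 (Pi.single i (G.hi) : Site (d + 2)) (Pi.single i R)) := by unfold m5G at ht; omega
      rw [pappend_add _ _ _ _ hj]
      obtain ⟨htr, hlev⟩ := p5 k hk
      have hlen : ((dist1 (Pi.single i (G.hi) : Site (d + 2)) (Pi.single i R)) : ℤ) = R - G.hi := (piece5G_spec G k hk).2.2
      refine ⟨Or.inr (Or.inr (Or.inr (Or.inr (Or.inl ⟨le_rfl, htr, by rw [hlev]; omega⟩)))), fun j => ?_⟩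
      by_cases hji : j = i
      · subst hji; rw [hlev, abs_le]; constructor <;> omega
      · rw [htr j hji]; simp only [abs_zero]; omega

/-- `A₆`: path, endpoints, points. [folklore] -/
theorem A6G_spec {R : ℤ} {i : Fin (d + 2)} (G : GadgetData i R) {x y : Site (d + 2)} (hx : ∀ j, |x j| ≤ R) (hxL : ∃ j, |x j| = R) (hy : ∀ j, |y j| ≤ R) (hlt : x i < y i) :
    PathOn (m6G G x y) (A6G G x y) ∧ A6G G x y 0 = x ∧ A6G G x y (m6G G x y) = liftPtG R i y ∧
    ∀ t ≤ m6G G x y, PQG G 6 x (A6G G x y t) ∧ InBoxR R (A6G G x y t) := by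
  obtain ⟨hP, h0, hend, hpts⟩ := A5G_spec G hx hxL hy hlt
  have hb := G.bounds
  have hyi : y i ≤ R := by have := hy i; rw [abs_le] at this; exact this.2
  have hj : A5G G x (m5G G x) = (gpath (Pi.single i R : Site (d + 2)) (liftPtG R i y)) 0 := by rw [hend]; rfl
  refine ⟨?_, ?_, ?_, ?_⟩
  · refine hP.append (pathOn_gpath _ _) hj fun s hs t ht1 ht2 heq => ?_
    have hz := (hpts s hs.le).1
    have hlev := (piece6G_spec R i y hy t).1
    have hlevz : A5G G x s i = R := by rw [heq]; exact hlev
    rcases hz with hz | hz | ⟨-, hz⟩ | ⟨-, hz⟩ | ⟨-, hz⟩ | ⟨h, -⟩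
    · have := hz.2.2; omega
    · omega
    · have := hz.2; omega
    · have := hz.2.1; omega
    · -- upper-axis point at level R: it is the top face centre `(gpath (Pi.single i R : Site (d + 2)) (liftPtG R i y)) 0`, excluded by injectivity
      have heq' : (gpath (Pi.single i R : Site (d + 2)) (liftPtG R i y)) t = (gpath (Pi.single i R : Site (d + 2)) (liftPtG R i y)) 0 := by
        rw [← heq, eq_single_of_transverse hz.1, hlevz]; rfl
      have := (pathOn_gpath (Pi.single i R : Site (d + 2)) (liftPtG R i y)).2
        (show t ≤ _ from ht2) (Nat.zero_le _) heq'
      omega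
    · omega
  · unfold A6G; rw [pappend_of_le _ _ (Nat.zero_le _), h0]
  · unfold A6G m6G; rw [pappend_add _ _ _ _ hj, gpath_of_ge _ _ le_rfl]
  · intro t ht
    unfold A6G
    rcases le_or_gt t (m5G G x) with h | h
    · rw [pappend_of_le _ _ h]; exact ⟨(hpts t h).1.mono (by norm_num), (hpts t h).2⟩
    · obtain ⟨k, rfl⟩ : ∃ k, t = m5G G x + k := ⟨t - m5G G x, by omega⟩
      rw [pappend_add _ _ _ _ hj]
      have := piece6G_spec R i y hy k
      exact ⟨Or.inr (Or.inr (Or.inr (Or.inr (Or.inr ⟨le_rfl, this.1⟩)))), this.2⟩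

/-- `A₇ = routeG`: path, endpoints, points. [folklore] -/
theorem A7G_spec {R : ℤ} {i : Fin (d + 2)} (G : GadgetData i R) {x y : Site (d + 2)} (hx : ∀ j, |x j| ≤ R) (hxL : ∃ j, |x j| = R) (hy : ∀ j, |y j| ≤ R)
    (hyL : ∃ j, |y j| = R) (hlt : x i < y i) :
    PathOn (m7G G x y) (A7G G x y) ∧ A7G G x y 0 = x ∧ A7G G x y (m7G G x y) = y ∧
    ∀ t ≤ m7G G x y, (PQG G 6 x (A7G G x y t) ∨ PS7G R i y (A7G G x y t)) ∧ InBoxR R (A7G G x y t) := by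
  obtain ⟨hP, h0, hend, hpts⟩ := A6G_spec G hx hxL hy hlt
  have hb := G.bounds
  have hxi : -R ≤ x i := by have := hx i; rw [abs_le] at this; exact this.1
  have hj : A6G G x y (m6G G x y) = (gpath (liftPtG R i y) y) 0 := by rw [hend]; rfl
  refine ⟨?_, ?_, ?_, ?_⟩
  · refine hP.append (pathOn_gpath _ _) hj fun s hs t ht1 ht2 heq => ?_
    have hz := (hpts s hs.le).1
    obtain ⟨hps7, -, hlev, hlen⟩ := piece7G_spec R i y hy t ht2
    have hlevz : A6G G x y s i = R - (t : ℤ) := by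
      rw [heq, hlev]; push_cast [Nat.cast_sub ht2]; linarith
    have hysmall : (∀ j, j ≠ i → |y j| ≤ R - 1) → False := fun hsm => by
      have := yi_eq_of_smallG hx hyL hlt hsm
      have : ((dist1 (liftPtG R i y) y) : ℤ) = 0 := by rw [hlen]; omega
      omega
    rcases hz with hz | hz | ⟨-, hz⟩ | ⟨-, hz⟩ | ⟨-, hz⟩ | ⟨-, hz⟩
    · have := hz.2.2
      have h2 := hps7.2.1
      rw [← heq] at h2
      omega
    · have h2 := hps7.2.1; rw [← heq] at h2; omega
    · exact hysmall fun j hj => by rw [← hps7.1 j hj, ← heq, hz.1 j hj]; simp only [abs_zero]; omega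
    · exact hysmall fun j hj => by rw [← hps7.1 j hj, ← heq]; exact (hz.2.2 j).trans (by omega)
    · exact hysmall fun j hj => by rw [← hps7.1 j hj, ← heq, hz.1 j hj]; simp only [abs_zero]; omega
    · omega
  · unfold A7G; rw [pappend_of_le _ _ (Nat.zero_le _), h0]
  · unfold A7G m7G; rw [pappend_add _ _ _ _ hj, gpath_of_ge _ _ le_rfl]
  · intro t ht
    unfold A7G
    rcases le_or_gt t (m6G G x y) with h | h
    · rw [pappend_of_le _ _ h]; exact ⟨Or.inl (hpts t h).1, (hpts t h).2⟩
    · obtain ⟨k, rfl⟩ : ∃ k, t = m6G G x y + k := ⟨t - m6G G x y, by omega⟩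
      have hk : k ≤ (dist1 (liftPtG R i y) y) := by unfold m7G at ht; omega
      rw [pappend_add _ _ _ _ hj]
      have := piece7G_spec R i y hy k hk
      exact ⟨Or.inr this.1, this.2.1⟩

end Cumulative

/-! ### Walks traced by lists of sites; the snake gadget -/

section SnakeGadget

variable {d : ℕ}

/-- The walk traced by a list of sites (frozen at the last entry), translated by `b`. [folklore] -/
def siteListWalk (b : Site (d + 2)) (l : List (Site (d + 2))) : ℕ → Site (d + 2) :=
  fun t => b + l.getD (min t (l.length - 1)) 0

/-- Values of the site-list walk inside the list. [folklore] -/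
theorem siteListWalk_apply {b : Site (d + 2)} {l : List (Site (d + 2))} {t : ℕ} (ht : t < l.length) :
    siteListWalk b l t = b + l[t] := by
  simp only [siteListWalk, min_eq_left (show t ≤ l.length - 1 by omega)]
  rw [List.getD_eq_getElem _ _ ht]

/-- A chain list without repetitions traces a self-avoiding path. [folklore] -/
theorem pathOn_siteListWalk {l : List (Site (d + 2))} (hc : l.IsChain (zdGraph (d + 2)).Adj)
    (hn : l.Nodup) (b : Site (d + 2)) : PathOn (l.length - 1) (siteListWalk b l) := by
  refine ⟨fun t ht => ?_, fun s hs t ht hst => ?_⟩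
  · rw [siteListWalk_apply (by omega), siteListWalk_apply (by omega), add_comm b, add_comm b,
      zdGraph_adj_add_right]
    exact (List.isChain_iff_getElem.1 hc) t (by omega)
  · simp only [Set.mem_setOf_eq] at hs ht
    rcases Nat.eq_zero_or_pos l.length with h0 | hpos
    · omega
    rw [siteListWalk_apply (by omega), siteListWalk_apply (by omega)] at hst
    exact (List.Nodup.getElem_inj_iff hn).1 (add_left_cancel hst)

/-- The transverse direction used by the snake gadget: `e₁` if the axis is `e₀`, else `e₀`.
[folklore] -/
def snakeDir (i : Fin (d + 2)) : Fin (d + 2) := if i = 0 then 1 else 0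

/-- `snakeDir i ≠ i`. [folklore] -/
theorem snakeDir_ne (i : Fin (d + 2)) : snakeDir i ≠ i := by
  unfold snakeDir; split_ifs with h
  · rw [h]; exact Fin.ne_of_val_ne (by simp)
  · exact Ne.symm h

/-- The base corner of the snake cube: level `-14` on the axis, one step off it. [folklore] -/
def snakeBase (i : Fin (d + 2)) : Site (d + 2) := Pi.single i (-14) + Pi.single (snakeDir i) 1

/-- The far corner of the snake cube. [folklore] -/
def snakeFar (i : Fin (d + 2)) : Site (d + 2) := snakeBase i + fun _ => 26

/-- The point above the far corner, where the gadget leaves the snake cube. [folklore] -/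
def snakeTop (i : Fin (d + 2)) : Site (d + 2) := snakeFar i + Pi.single i 1

/-- Length of the snake piece. [folklore] -/
def snakeLen (d : ℕ) : ℕ := 27 ^ (d + 2) - 1

/-- The level of the base corner. [folklore] -/
theorem snakeBase_self (i : Fin (d + 2)) : snakeBase i i = -14 := by
  simp [snakeBase, Pi.single_eq_of_ne (snakeDir_ne i).symm]

/-- The transverse offset of the base corner. [folklore] -/
theorem snakeBase_dir (i : Fin (d + 2)) : snakeBase i (snakeDir i) = 1 := by
  simp [snakeBase, Pi.single_eq_of_ne (snakeDir_ne i)]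

/-- The other coordinates of the base corner vanish. [folklore] -/
theorem snakeBase_other (i : Fin (d + 2)) {j : Fin (d + 2)} (hj : j ≠ i) (hj' : j ≠ snakeDir i) :
    snakeBase i j = 0 := by
  simp [snakeBase, Pi.single_eq_of_ne hj, Pi.single_eq_of_ne hj']

/-- All coordinates of the base corner are in `[-14, 1]`. [folklore] -/
theorem snakeBase_bounds (i j : Fin (d + 2)) : -14 ≤ snakeBase i j ∧ snakeBase i j ≤ 1 := by
  by_cases hj : j = i
  · subst hj; rw [snakeBase_self]; norm_num
  by_cases hj' : j = snakeDir i
  · subst hj'; rw [snakeBase_dir]; norm_num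
  rw [snakeBase_other i hj hj']; norm_num

/-- The level of the exit point is `13`, its other coordinates are those of the far corner.
[folklore] -/
theorem snakeTop_apply (i : Fin (d + 2)) :
    snakeTop i i = 13 ∧ ∀ j, j ≠ i → snakeTop i j = snakeBase i j + 26 := by
  refine ⟨?_, fun j hj => ?_⟩
  · simp [snakeTop, snakeFar, snakeBase_self]
  · simp [snakeTop, snakeFar, Pi.single_eq_of_ne hj]

/-- The distance from the axis entry to the base corner is `1`. [folklore] -/
theorem dist1_entry_base (i : Fin (d + 2)) : dist1 (Pi.single i (-14) : Site (d + 2)) (snakeBase i) = 1 := by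
  have hne := snakeDir_ne i
  have hag : ∀ j, j ≠ snakeDir i → (Pi.single i (-14) : Site (d + 2)) j = snakeBase i j := by
    intro j hj
    by_cases hji : j = i
    · subst hji; rw [snakeBase_self]; simp
    · rw [Pi.single_eq_of_ne hji, snakeBase_other i hji hj]
  rw [dist1_of_agree hag, snakeBase_dir, Pi.single_eq_of_ne hne]; rfl

/-- The distance from the far corner to the exit point is `1`. [folklore] -/
theorem dist1_far_top (i : Fin (d + 2)) : dist1 (snakeFar i) (snakeTop i) = 1 := by
  rw [dist1_of_agree (i := i) (fun j hj => by simp [snakeTop, Pi.single_eq_of_ne hj])]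
  simp [snakeTop]

/-- The number of points of the snake. [folklore] -/
theorem length_snakeList27 (d : ℕ) : (snakeList (d + 2) 26).length = 27 ^ (d + 2) := by
  rw [length_snakeList]

/-- `27^{d+2} ≥ 1`. [folklore] -/
theorem one_le_pow27 (d : ℕ) : 1 ≤ 27 ^ (d + 2) := Nat.one_le_pow _ _ (by norm_num)

/-- Points of the snake piece: `base + p` with `p ∈ {0,…,26}^{d+2}`. [folklore] -/
theorem snake_point (i : Fin (d + 2)) {t : ℕ} (ht : t < 27 ^ (d + 2)) :
    ∃ p : Site (d + 2), (∀ j, 0 ≤ p j ∧ p j ≤ 26) ∧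
      siteListWalk (snakeBase i) (snakeList (d + 2) 26) t = snakeBase i + p := by
  refine ⟨(snakeList (d + 2) 26)[t]'(by rw [length_snakeList27]; exact ht), ?_, siteListWalk_apply _⟩
  exact mem_snakeList.1 (List.getElem_mem _)

/-- The snake starts at the base corner. [folklore] -/
theorem snake_first (i : Fin (d + 2)) : siteListWalk (snakeBase i) (snakeList (d + 2) 26) 0 = snakeBase i := by
  rw [siteListWalk_apply (by rw [length_snakeList27]; exact one_le_pow27 d)]
  have h0 := head_snakeList (d + 2) 26
  rw [List.head?_eq_getElem?, List.getElem?_eq_getElem (by rw [length_snakeList27]; exact one_le_pow27 d)] at h0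
  rw [Option.some_injective _ h0, add_zero]

/-- The snake ends at the far corner. [folklore] -/
theorem snake_last (i : Fin (d + 2)) :
    siteListWalk (snakeBase i) (snakeList (d + 2) 26) (snakeLen d) = snakeFar i := by
  have h := length_snakeList27 d
  have h1 := one_le_pow27 d
  rw [siteListWalk_apply (by rw [h]; unfold snakeLen; omega)]
  have hL := getLast_snakeList (d + 2) (by norm_num : 26 % 2 = 0)
  rw [List.getLast?_eq_getElem?, List.getElem?_eq_getElem (by rw [h]; omega)] at hL
  have hidx : (snakeList (d + 2) 26).length - 1 = snakeLen d := by rw [h]; rfl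
  simp only [hidx] at hL
  rw [Option.some_injective _ hL]
  rfl

/-- The pieces `A ++ B` of the snake gadget (entry step, then the snake). [folklore] -/
def snakeAB (i : Fin (d + 2)) : ℕ → Site (d + 2) :=
  pappend 1 (gpath (Pi.single i (-14)) (snakeBase i)) (siteListWalk (snakeBase i) (snakeList (d + 2) 26))

/-- The pieces `A ++ B ++ C`. [folklore] -/
def snakeABC (i : Fin (d + 2)) : ℕ → Site (d + 2) :=
  pappend (snakeLen d + 1) (snakeAB i) (gpath (snakeFar i) (snakeTop i))

/-- The four pieces of the snake gadget concatenated: axis point → base corner, the snake through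
`base + {0,…,26}^{d+2}`, one step up from the far corner, greedy path at level `13` back to the
axis. [folklore] -/
def snakeGadgetWalk (i : Fin (d + 2)) : ℕ → Site (d + 2) :=
  pappend (snakeLen d + 2) (snakeABC i) (gpath (snakeTop i) (Pi.single i 13))

/-- Length of the snake gadget. [folklore] -/
def snakeGadgetLen (i : Fin (d + 2)) : ℕ := snakeLen d + 2 + dist1 (snakeTop i) (Pi.single i 13 : Site (d + 2))

/-- Junction `A`/`B`. [folklore] -/
theorem snake_jAB (i : Fin (d + 2)) :
    gpath (Pi.single i (-14) : Site (d + 2)) (snakeBase i) 1 = siteListWalk (snakeBase i) (snakeList (d + 2) 26) 0 := by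
  rw [← dist1_entry_base i, gpath_of_ge _ _ le_rfl, snake_first]

/-- Values of `snakeAB`. [folklore] -/
theorem snakeAB_apply (i : Fin (d + 2)) :
    snakeAB i 0 = Pi.single i (-14) ∧
      ∀ k, snakeAB i (1 + k) = siteListWalk (snakeBase i) (snakeList (d + 2) 26) k := by
  refine ⟨by unfold snakeAB; rw [pappend_of_le _ _ (Nat.zero_le _), gpath_zero], fun k => ?_⟩
  unfold snakeAB
  rw [pappend_add _ _ _ _ (snake_jAB i)]

/-- `snakeAB` is a self-avoiding path (the entry point is off the snake cube: its transverse
coordinate is `0`). [folklore] -/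
theorem pathOn_snakeAB (i : Fin (d + 2)) : PathOn (snakeLen d + 1) (snakeAB i) := by
  have hne := snakeDir_ne i
  have hA : PathOn 1 (gpath (Pi.single i (-14) : Site (d + 2)) (snakeBase i)) := by
    have := pathOn_gpath (Pi.single i (-14) : Site (d + 2)) (snakeBase i)
    rwa [dist1_entry_base] at this
  have hB : PathOn (snakeLen d) (siteListWalk (snakeBase i) (snakeList (d + 2) 26)) := by
    have := pathOn_siteListWalk (isChain_snakeList (d + 2) (by norm_num : 26 % 2 = 0))
      (nodup_snakeList (d + 2) 26) (snakeBase i)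
    rwa [length_snakeList27] at this
  have := hA.append hB (snake_jAB i) fun s hs t ht1 ht2 heq => ?_
  · unfold snakeAB; rwa [show 1 + snakeLen d = snakeLen d + 1 by ring] at this
  · have hs0 : s = 0 := by omega
    subst hs0
    rw [gpath_zero] at heq
    obtain ⟨p, hp, e⟩ := snake_point i (show t < 27 ^ (d + 2) by unfold snakeLen at ht2; have := one_le_pow27 d; omega)
    rw [e] at heq
    have := congrFun heq (snakeDir i)
    rw [Pi.add_apply, snakeBase_dir, Pi.single_eq_of_ne hne] at this
    have := (hp (snakeDir i)).1
    omega

/-- Levels and coordinates of the points of `snakeAB`. [folklore] -/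
theorem snakeAB_ranges (i : Fin (d + 2)) {s : ℕ} (hs : s ≤ snakeLen d + 1) :
    (-14 ≤ snakeAB i s i ∧ snakeAB i s i ≤ 12) ∧ ∀ j, |snakeAB i s j| ≤ 27 := by
  obtain ⟨h0, hk⟩ := snakeAB_apply i
  rcases Nat.eq_zero_or_pos s with rfl | hpos
  · rw [h0]
    refine ⟨by simp, fun j => ?_⟩
    by_cases hj : j = i
    · subst hj; simp
    · rw [Pi.single_eq_of_ne hj]; simp
  · obtain ⟨k, rfl⟩ : ∃ k, s = 1 + k := ⟨s - 1, by omega⟩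
    rw [hk k]
    obtain ⟨p, hp, e⟩ := snake_point i (show k < 27 ^ (d + 2) by unfold snakeLen at hs; have := one_le_pow27 d; omega)
    rw [e]
    refine ⟨?_, fun j => ?_⟩
    · rw [Pi.add_apply, snakeBase_self]; have := hp i; omega
    · rw [Pi.add_apply, abs_le]; have := hp j; have := snakeBase_bounds i j; omega

/-- Junction `B`/`C`. [folklore] -/
theorem snake_jC (i : Fin (d + 2)) : snakeAB i (snakeLen d + 1) = gpath (snakeFar i) (snakeTop i) 0 := by
  rw [show snakeLen d + 1 = 1 + snakeLen d by ring, (snakeAB_apply i).2, snake_last, gpath_zero]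

/-- `snakeABC` is a self-avoiding path (the exit point has level `13`, above the snake cube).
[folklore] -/
theorem pathOn_snakeABC (i : Fin (d + 2)) : PathOn (snakeLen d + 2) (snakeABC i) := by
  have hC : PathOn 1 (gpath (snakeFar i) (snakeTop i)) := by
    have := pathOn_gpath (snakeFar i) (snakeTop i); rwa [dist1_far_top] at this
  have := (pathOn_snakeAB i).append hC (snake_jC i) fun s hs t ht1 ht2 heq => ?_
  · unfold snakeABC; exact this
  · have ht : t = 1 := by omega
    subst ht
    rw [← dist1_far_top i, gpath_of_ge _ _ le_rfl] at heq
    have h1 := (snakeAB_ranges i hs.le).1.2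
    rw [heq, (snakeTop_apply i).1] at h1
    norm_num at h1

/-- Values of `snakeABC`. [folklore] -/
theorem snakeABC_apply (i : Fin (d + 2)) :
    (∀ s ≤ snakeLen d + 1, snakeABC i s = snakeAB i s) ∧ snakeABC i (snakeLen d + 2) = snakeTop i := by
  refine ⟨fun s hs => by unfold snakeABC; rw [pappend_of_le _ _ hs], ?_⟩
  unfold snakeABC
  rw [show snakeLen d + 2 = (snakeLen d + 1) + 1 by ring, pappend_add _ _ _ _ (snake_jC i),
    ← dist1_far_top i, gpath_of_ge _ _ le_rfl]

/-- Junction `C`/`D`. [folklore] -/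
theorem snake_jD (i : Fin (d + 2)) : snakeABC i (snakeLen d + 2) = gpath (snakeTop i) (Pi.single i 13) 0 := by
  rw [(snakeABC_apply i).2, gpath_zero]

/-- Piece `D` stays at level `13`; its coordinates lie between those of the exit point and `0`.
[folklore] -/
theorem snakeD_spec (i : Fin (d + 2)) (k : ℕ) :
    gpath (snakeTop i) (Pi.single i 13 : Site (d + 2)) k i = 13 ∧
      ∀ j, |gpath (snakeTop i) (Pi.single i 13 : Site (d + 2)) k j| ≤ 27 := by
  obtain ⟨htop, hoth⟩ := snakeTop_apply i
  refine ⟨by rw [gpath_apply_of_eq (by rw [htop]; simp), htop], fun j => ?_⟩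
  have hmem := gpath_apply_mem (snakeTop i) (Pi.single i 13 : Site (d + 2)) j k
  by_cases hj : j = i
  · subst hj; rw [htop, Pi.single_eq_same] at hmem; rw [abs_le]; omega
  · rw [hoth j hj, Pi.single_eq_of_ne hj] at hmem
    have := snakeBase_bounds i j
    rw [abs_le]; omega

/-- **The snake gadget is a gadget** for the axis `i` in the cube of radius `30`
(`lo = -14`, `hi = 13`, `β = 27`). [folklore] -/
def snakeGadget (i : Fin (d + 2)) : GadgetData i 30 where
  g := snakeGadgetWalk i
  len := snakeGadgetLen i
  lo := -14
  hi := 13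
  β := 27
  pathOn := by
    have := (pathOn_snakeABC i).append (pathOn_gpath (snakeTop i) (Pi.single i 13)) (snake_jD i)
      fun s hs t ht1 ht2 heq => ?_
    · exact this
    · -- prefix levels are ≤ 12 at times ≤ snakeLen d + 1; piece-D points have level 13 and are
      -- distinct from the exit point (injectivity)
      have h13 := (snakeD_spec i t).1
      rcases Nat.lt_or_ge s (snakeLen d + 2) with h | h
      · rw [(snakeABC_apply i).1 s (by omega)] at heq
        have := (snakeAB_ranges i (s := s) (by omega)).1.2
        rw [heq, h13] at this
        omega
      · omega
  g_zero := by
    show snakeGadgetWalk i 0 = _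
    unfold snakeGadgetWalk
    rw [pappend_of_le _ _ (Nat.zero_le _), (snakeABC_apply i).1 0 (Nat.zero_le _), (snakeAB_apply i).1]
  g_len := by
    show snakeGadgetWalk i (snakeGadgetLen i) = _
    unfold snakeGadgetWalk snakeGadgetLen
    rw [pappend_add _ _ _ _ (snake_jD i), gpath_of_ge _ _ le_rfl]
  ranges := by
    intro t ht
    show (-14 ≤ snakeGadgetWalk i t i ∧ snakeGadgetWalk i t i ≤ 13) ∧ ∀ j, |snakeGadgetWalk i t j| ≤ 27
    unfold snakeGadgetWalk
    rcases le_or_gt t (snakeLen d + 2) with h | h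
    · rw [pappend_of_le _ _ h]
      rcases h.lt_or_eq with h' | rfl
      · rw [(snakeABC_apply i).1 t (by omega)]
        have := snakeAB_ranges i (show t ≤ snakeLen d + 1 by omega)
        exact ⟨⟨this.1.1, by linarith [this.1.2]⟩, this.2⟩
      · rw [(snakeABC_apply i).2]
        obtain ⟨htop, hoth⟩ := snakeTop_apply i
        refine ⟨by rw [htop]; norm_num, fun j => ?_⟩
        by_cases hj : j = i
        · subst hj; rw [htop]; norm_num
        · rw [hoth j hj, abs_le]; have := snakeBase_bounds i j; omega
    · obtain ⟨k, rfl⟩ : ∃ k, t = snakeLen d + 2 + k := ⟨t - (snakeLen d + 2), by omega⟩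
      rw [pappend_add _ _ _ _ (snake_jD i)]
      have := snakeD_spec i k
      exact ⟨by rw [this.1]; norm_num, this.2⟩
  bounds := by norm_num

/-- Every point of the snake cube `base + {0,…,26}^{d+2}` is a point of the snake gadget.
[folklore] -/
theorem snakeGadget_covers (i : Fin (d + 2)) (z : Site (d + 2))
    (hz : ∀ j, 0 ≤ z j - snakeBase i j ∧ z j - snakeBase i j ≤ 26) :
    ∃ t ≤ (snakeGadget i).len, (snakeGadget i).g t = z := by
  have hmem : (z - snakeBase i) ∈ snakeList (d + 2) 26 := mem_snakeList.2 fun j => by simpa using hz j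
  obtain ⟨k, hk, e⟩ := List.getElem_of_mem hmem
  rw [length_snakeList27] at hk
  refine ⟨1 + k, ?_, ?_⟩
  · show 1 + k ≤ snakeGadgetLen i
    unfold snakeGadgetLen snakeLen; omega
  · show snakeGadgetWalk i (1 + k) = z
    unfold snakeGadgetWalk
    rw [pappend_of_le _ _ (by unfold snakeLen; omega), (snakeABC_apply i).1 _ (by unfold snakeLen; omega),
      (snakeAB_apply i).2 k, siteListWalk_apply (by rw [length_snakeList27]; exact hk), e]
    abel

/-- The centre of the snake cube. [folklore] -/
def snakeCentre (i : Fin (d + 2)) : Site (d + 2) := snakeBase i + fun _ => 13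

/-- The cube of radius `13` around the centre of the snake cube consists of gadget points; the
centre itself is the gadget point used as marker. [folklore] -/
theorem snakeGadget_marker (i : Fin (d + 2)) :
    (∃ t ≤ (snakeGadget i).len, (snakeGadget i).g t = snakeCentre i) ∧
      ∀ z : Site (d + 2), (∀ j, |z j - snakeCentre i j| ≤ 13) → ∃ t ≤ (snakeGadget i).len, (snakeGadget i).g t = z := by
  refine ⟨snakeGadget_covers i _ fun j => by simp [snakeCentre], fun z hz => snakeGadget_covers i z fun j => ?_⟩
  have := hz j
  simp only [snakeCentre, Pi.add_apply] at this
  rw [abs_le] at this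
  omega

end SnakeGadget

/-! ### The generic routing theorem -/

section RouteG

variable {d : ℕ} {R : ℤ} {i : Fin (d + 2)} (G : GadgetData i R) {x y : Site (d + 2)}

/-- Evaluation of `A₇` on the gadget. [folklore] -/
theorem A7G_gadget (hx : ∀ j, |x j| ≤ R) (hxL : ∃ j, |x j| = R) (hy : ∀ j, |y j| ≤ R)
    (hlt : x i < y i) {k : ℕ} (hk : k ≤ G.len) : A7G G x y (m3G G x + k) = G.g k := by
  have h5 : m4G G x ≤ m5G G x := Nat.le_add_right _ _
  have h6 : m5G G x ≤ m6G G x y := Nat.le_add_right _ _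
  have hj : A3G G x (m3G G x) = G.g 0 := by rw [(A3G_spec G hx hxL hy hlt).2.2.1, G.g_zero]
  have h4 : m3G G x + k ≤ m4G G x := by unfold m4G; omega
  unfold A7G A6G A5G A4G
  rw [pappend_of_le _ _ (by omega), pappend_of_le _ _ (by omega), pappend_of_le _ _ h4,
    pappend_add _ _ _ _ hj]

/-- Points of the cube of radius `R` are at `ℓ¹` distance at most `2R(d+2)`. [folklore] -/
theorem dist1_le_of_inBoxR {z q : Site (d + 2)} (hz : InBoxR R z) (hq : InBoxR R q) :
    (dist1 z q : ℤ) ≤ 2 * R * (d + 2) := by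
  unfold dist1
  push_cast
  have : ∀ j, |q j - z j| ≤ 2 * R := fun j => by
    have h1 := hz j; have h2 := hq j; rw [abs_le] at h1 h2 ⊢; omega
  calc ∑ j, |q j - z j| ≤ ∑ _j : Fin (d + 2), 2 * R := Finset.sum_le_sum fun j _ => this j
    _ = 2 * R * (d + 2) := by simp [mul_comm]

/-- The length bound for the generic route. [folklore] -/
theorem m7G_le (hx : ∀ j, |x j| ≤ R) (hy : ∀ j, |y j| ≤ R) :
    (m7G G x y : ℤ) ≤ 12 * R * (d + 2) + G.len := by
  have hb := G.bounds
  have hR : 0 ≤ R := by omega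
  have b1 : InBoxR R x := hx
  have b2 : InBoxR R (dropPtG R i x) := fun j => by
    by_cases hj : j = i
    · subst hj; simp [dropPtG, abs_le]; omega
    · rw [← (dropPtG_spec R i x).1 j hj]; exact hx j
  have b3 : InBoxR R (Pi.single i (-R) : Site (d + 2)) := fun j => by
    by_cases hj : j = i
    · subst hj; simp [abs_le]; omega
    · rw [Pi.single_eq_of_ne hj]; simp [hR]
  have b4 : InBoxR R (Pi.single i G.lo : Site (d + 2)) := fun j => by
    by_cases hj : j = i
    · subst hj; simp [abs_le]; omega
    · rw [Pi.single_eq_of_ne hj]; simp [hR]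
  have b5 : InBoxR R (Pi.single i G.hi : Site (d + 2)) := fun j => by
    by_cases hj : j = i
    · subst hj; simp [abs_le]; omega
    · rw [Pi.single_eq_of_ne hj]; simp [hR]
  have b6 : InBoxR R (Pi.single i R : Site (d + 2)) := fun j => by
    by_cases hj : j = i
    · subst hj; simp [abs_le]; omega
    · rw [Pi.single_eq_of_ne hj]; simp [hR]
  have b7 : InBoxR R (liftPtG R i y) := fun j => by
    by_cases hj : j = i
    · subst hj; simp [liftPtG, abs_le]; omega
    · rw [(liftPtG_spec R i y).1 j hj]; exact hy j
  have b8 : InBoxR R y := hy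
  unfold m7G m6G m5G m4G m3G m2G m1G
  push_cast
  have := dist1_le_of_inBoxR b1 b2; have := dist1_le_of_inBoxR b2 b3; have := dist1_le_of_inBoxR b3 b4
  have := dist1_le_of_inBoxR b5 b6; have := dist1_le_of_inBoxR b6 b7; have := dist1_le_of_inBoxR b7 b8
  linarith

variable {G}

/-- **Generic routing theorem.** Let `R > 0` and suppose given a gadget `Gs i` for every axis
`i` in the cube of radius `R`, of length at most `Λ`. Then for `x ≠ y` on the outer layer of
`c + [-R, R]^{d+2}` there is a self-avoiding nearest-neighbour path inside the cube from `x` to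
`y`, of length at most `12R(d+2) + Λ`, containing a translate by `c` of one of the gadgets (all
its points are points of the path). [folklore] -/
theorem exists_routeG {R : ℤ} (Gs : ∀ i : Fin (d + 2), GadgetData i R) {Λ : ℕ} (hΛ : ∀ i, (Gs i).len ≤ Λ)
    (c x y : Site (d + 2)) (hx : ∀ j, |x j - c j| ≤ R) (hxL : ∃ j, |x j - c j| = R)
    (hy : ∀ j, |y j - c j| ≤ R) (hyL : ∃ j, |y j - c j| = R) (hne : x ≠ y) :
    ∃ (L : ℕ) (π : ℕ → Site (d + 2)), (L : ℤ) ≤ 12 * R * (d + 2) + Λ ∧ π 0 = x ∧ π L = y ∧ PathOn L π ∧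
      (∀ t ≤ L, ∀ j, |π t j - c j| ≤ R) ∧
      ∃ i : Fin (d + 2), ∀ k ≤ (Gs i).len, ∃ t ≤ L, π t = c + (Gs i).g k := by
  set x' : Site (d + 2) := x - c with hx'
  set y' : Site (d + 2) := y - c with hy'
  have hx1 : ∀ j, |x' j| ≤ R := fun j => by simpa [hx'] using hx j
  have hx2 : ∃ j, |x' j| = R := by simpa [hx'] using hxL
  have hy1 : ∀ j, |y' j| ≤ R := fun j => by simpa [hy'] using hy j
  have hy2 : ∃ j, |y' j| = R := by simpa [hy'] using hyL
  have hne' : x' ≠ y' := fun h => hne (by simpa [hx', hy'] using congrArg (· + c) h)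
  obtain ⟨i, hi⟩ : ∃ i, x' i ≠ y' i := by
    by_contra h; push Not at h; exact hne' (funext h)
  have pack : ∀ (L : ℕ) (ρ : ℕ → Site (d + 2)), (L : ℤ) ≤ 12 * R * (d + 2) + Λ → ρ 0 = x' → ρ L = y' →
      PathOn L ρ → (∀ t ≤ L, InBoxR R (ρ t)) → (∀ k ≤ (Gs i).len, ∃ t ≤ L, ρ t = (Gs i).g k) →
      ∃ (L : ℕ) (π : ℕ → Site (d + 2)), (L : ℤ) ≤ 12 * R * (d + 2) + Λ ∧ π 0 = x ∧ π L = y ∧ PathOn L π ∧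
        (∀ t ≤ L, ∀ j, |π t j - c j| ≤ R) ∧
        ∃ i : Fin (d + 2), ∀ k ≤ (Gs i).len, ∃ t ≤ L, π t = c + (Gs i).g k := by
    intro L ρ hL h0 hend hP hbox hg
    refine ⟨L, fun t => c + ρ t, hL, by simp [h0, hx'], by simp [hend, hy'], hP.add_const c,
      fun t ht j => by simpa using hbox t ht j, i, fun k hk => ?_⟩
    obtain ⟨t, ht, e⟩ := hg k hk
    exact ⟨t, ht, by show c + ρ t = c + (Gs i).g k; rw [e]⟩
  rcases lt_or_gt_of_ne hi with hlt | hlt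
  · obtain ⟨hP, h0, hend, hpts⟩ := A7G_spec (Gs i) hx1 hx2 hy1 hy2 hlt
    refine pack _ _ ((m7G_le (Gs i) hx1 hy1).trans (by have := hΛ i; omega)) h0 hend hP
      (fun t ht => (hpts t ht).2) fun k hk => ⟨m3G (Gs i) x' + k, ?_, A7G_gadget (Gs i) hx1 hx2 hy1 hlt hk⟩
    unfold m7G m6G m5G m4G; omega
  · obtain ⟨hP, h0, hend, hpts⟩ := A7G_spec (Gs i) hy1 hy2 hx1 hx2 hlt
    refine pack (m7G (Gs i) y' x') (preverse (m7G (Gs i) y' x') (A7G (Gs i) y' x'))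
      ((m7G_le (Gs i) hy1 hx1).trans (by have := hΛ i; omega))
      (by simp [preverse, hend]) (by simp [preverse, h0]) hP.reverse
      (fun t ht => by simp only [preverse]; exact (hpts _ (by omega)).2) fun k hk => ?_
    refine ⟨m7G (Gs i) y' x' - (m3G (Gs i) y' + k), by omega, ?_⟩
    simp only [preverse]
    have : m3G (Gs i) y' + k ≤ m7G (Gs i) y' x' := by unfold m7G m6G m5G m4G; omega
    rw [show m7G (Gs i) y' x' - (m7G (Gs i) y' x' - (m3G (Gs i) y' + k)) = m3G (Gs i) y' + k by omega]
    exact A7G_gadget (Gs i) hy1 hy2 hx1 hlt hk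

/-- **The snake route.** For `x ≠ y` on the outer layer of `c + [-30,30]^{d+2}` there is a
self-avoiding path inside this cube from `x` to `y`, of length at most `27^{d+2} + 420(d+2) + 1`,
one of whose points `π t₀` is the centre of a cube of radius `13` all of whose points are points
of `π` (the path "completely covers" that cube: the marker event `E*` of Madras–Slade Lemma
7.2.6, created here by the boustrophedon snake of Lemma 7.2.4(a)).
[cite: MadrasSlade1993, Lemma 7.2.4 and Lemma 7.2.6 (proof)] -/
theorem exists_snake_route (c x y : Site (d + 2)) (hx : ∀ j, |x j - c j| ≤ 30) (hxL : ∃ j, |x j - c j| = 30)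
    (hy : ∀ j, |y j - c j| ≤ 30) (hyL : ∃ j, |y j - c j| = 30) (hne : x ≠ y) :
    ∃ (L : ℕ) (π : ℕ → Site (d + 2)), L ≤ 27 ^ (d + 2) + 420 * (d + 2) + 1 ∧ π 0 = x ∧ π L = y ∧
      PathOn L π ∧ (∀ t ≤ L, ∀ j, |π t j - c j| ≤ 30) ∧
      ∃ t₀ ≤ L, ∀ z : Site (d + 2), (∀ j, |z j - π t₀ j| ≤ 13) → ∃ t ≤ L, π t = z := by
  have hΛ : ∀ i : Fin (d + 2), (snakeGadget i).len ≤ 27 ^ (d + 2) + 60 * (d + 2) + 1 := by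
    intro i
    show snakeGadgetLen i ≤ _
    unfold snakeGadgetLen snakeLen
    have hb : InBoxR 30 (snakeTop i) := fun j => by
      obtain ⟨htop, hoth⟩ := snakeTop_apply i
      by_cases hj : j = i
      · subst hj; rw [htop]; norm_num
      · rw [hoth j hj, abs_le]; have := snakeBase_bounds i j; omega
    have hb' : InBoxR 30 (Pi.single i 13 : Site (d + 2)) := fun j => by
      by_cases hj : j = i
      · subst hj; simp
      · rw [Pi.single_eq_of_ne hj]; norm_num
    have := dist1_le_of_inBoxR hb hb'
    have h1 := one_le_pow27 d
    omega
  obtain ⟨L, π, hL, h0, hend, hP, hbox, i, hg⟩ :=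
    exists_routeG (fun i => snakeGadget i) hΛ c x y hx hxL hy hyL hne
  refine ⟨L, π, by zify; push_cast at hL ⊢; linarith, h0, hend, hP, hbox, ?_⟩
  obtain ⟨⟨tc, htc, etc⟩, hcov⟩ := snakeGadget_marker i
  obtain ⟨t₀, ht₀, e₀⟩ := hg tc htc
  refine ⟨t₀, ht₀, fun z hz => ?_⟩
  have hz' : ∀ j, |(z - c) j - snakeCentre i j| ≤ 13 := fun j => by
    have := hz j; rw [e₀, etc] at this; simpa [sub_sub] using this
  obtain ⟨k, hk, ek⟩ := hcov (z - c) hz'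
  obtain ⟨t, ht, et⟩ := hg k hk
  exact ⟨t, ht, by rw [et, ek]; abel⟩

end RouteG

end Literature.Probability.RandomPlanarGeometry.SAW.Zd
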